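import Mathlib.Dynamics.PeriodicPts.Defs
import Mathlib.Data.ZMod.Basic
import Literature.AnabelianGeometry.SemiGraphs.BouquetCriteria
import Literature.AnabelianGeometry.SemiGraphs.ZariskiMainTheoremProofs

/-!
# Connected finite graph-coverings of `H_1` are cycles ([SemiAnbd] Remark 1.5.1 (1), p. 18–19)

Mochizuki, *Semi-graphs of anabelioids*, Publ. RIMS **42** (2006) 221–322, §1, Remark 1.5.1, author's
manuscript pp. 18–19 [cite: MochizukiSemiAnbd2006, Rem. 1.5.1(1) p.18]: "Since the (topological)
fundamental group of `H_1` is equal to `ℤ`, the isomorphism class of a (connected) finite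
graph-covering `G′ → H_1` of `H_1` is determined by its degree `d`": a connected finite graph-covering
of the one-loop graph `H_1` of degree `n` (i.e. with `n` vertices) is an `n`-cycle.

This file proves that structure statement in the form used to discharge Remark 1.5.1 (1)
(`SemiGraph.exists_cyclicIndex`): for a finite graph-covering `φ : G → H_1` with `G` connected and
`n = #𝒱_G ≥ 1` vertices, every branch of `G` abuts to a vertex, every vertex carries exactly one
leaving branch `out v` (direction bit `true` under `φ`), and there is a bijective *cyclic index*
`idx : 𝒱_G → ℤ/n` which increases by `1` along every edge (from the vertex of its leaving branch to the
vertex of its entering branch).  Proof: the successor map "follow the leaving edge" is a permutation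
(excision), all vertices lie in one orbit (connectedness, by an invariant along the barycentric
subdivision), and the orbit of a point of a permutation of a finite set is a cycle of length its
minimal period, here `n`.  Proof-only (no definitions).
-/

namespace Literature.AnabelianGeometry.SemiGraphs

namespace SemiGraph

open CategoryTheory

universe u

/-- **Cycle structure of connected finite coverings of `H_1`** ([SemiAnbd] Rmk. 1.5.1 (1)): for a
finite graph-covering `φ : G → H_1` with `G` connected and `Nat.card 𝒱_G = n ≥ 1`: all branches abut;
there are a leaving branch `out v` at every vertex and a bijective index `idx : 𝒱_G → ℤ/n` with
`idx v' = idx v + 1` whenever an edge leaves `v` (branch of direction `true` at `v`) and enters `v'`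
(branch of direction `false` at `v'`). [cite: MochizukiSemiAnbd2006, Rem. 1.5.1(1) p.18] -/
theorem exists_cyclicIndex {G : SemiGraph.{u}} (φ : G ⟶ bouquet.{u} 1) {n : ℕ} (hn : 1 ≤ n)
    (hG : G.IsConnected) (hcov : IsFiniteGraphCovering φ) (hcard : Nat.card G.Vertex = n) :
    ∃ (idx : G.Vertex → ZMod n) (out : G.Vertex → G.Branch),
      Function.Bijective idx ∧ (∀ v, G.abuts (out v) = some v) ∧
      (∀ v, (φ.branchMap (out v)).down.2 = true) ∧ (∀ b : G.Branch, (G.abuts b).isSome) ∧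
      ∀ (b b' : G.Branch) (v v' : G.Vertex), G.abuts b = some v → (φ.branchMap b).down.2 = true →
        G.edgeOf b' = G.edgeOf b → (φ.branchMap b').down.2 = false → G.abuts b' = some v' →
        idx v' = idx v + 1 := by
  classical
  haveI : NeZero n := ⟨by omega⟩
  haveI : Finite G.Vertex := Nat.finite_of_card_ne_zero (by omega)
  obtain ⟨⟨hprop, hexc⟩, -, -⟩ := hcov
  /- (1) the branch of direction `δ` at a vertex (excision) -/
  let sb : ∀ (v : G.Vertex) (δ : Bool), G.Star v := fun v δ =>
    (Equiv.ofBijective _ (hexc v)).symm ⟨⟨(0, δ)⟩, rfl⟩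
  have hsb_dir : ∀ v δ, (φ.branchMap (sb v δ).1).down.2 = δ := by
    intro v δ
    have := (Equiv.ofBijective _ (hexc v)).apply_symm_apply ⟨⟨(0, δ)⟩, rfl⟩
    exact congrArg (fun x : (bouquet.{u} 1).Star (φ.vertexMap v) => x.1.down.2) this
  have hsb_uniq : ∀ (v : G.Vertex) (δ : Bool) (b : G.Branch), G.abuts b = some v →
      (φ.branchMap b).down.2 = δ → b = (sb v δ).1 := by
    intro v δ b hb hδ
    have himg : Hom.starMap φ v ⟨b, hb⟩ = ⟨⟨(0, δ)⟩, rfl⟩ := by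
      apply Subtype.ext
      apply ULift.ext
      refine Prod.ext (Subsingleton.elim _ _) ?_
      exact hδ
    have := congrArg Subtype.val ((Equiv.ofBijective _ (hexc v)).injective
      (himg.trans ((Equiv.ofBijective _ (hexc v)).apply_symm_apply ⟨⟨(0, δ)⟩, rfl⟩).symm))
    exact this
  /- (2) the branch of direction `δ` of an edge -/
  let eb : ∀ (e : G.Edge) (δ : Bool), {b : G.Branch // G.edgeOf b = e} := fun e δ =>
    (Equiv.ofBijective _ (dir_bijective φ e)).symm δ
  have heb_dir : ∀ e δ, (φ.branchMap (eb e δ).1).down.2 = δ := fun e δ =>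
    (Equiv.ofBijective _ (dir_bijective φ e)).apply_symm_apply δ
  have heb_uniq : ∀ (e : G.Edge) (δ : Bool) (b : G.Branch), G.edgeOf b = e →
      (φ.branchMap b).down.2 = δ → b = (eb e δ).1 := by
    intro e δ b he hδ
    have := (Equiv.ofBijective _ (dir_bijective φ e)).injective
      ((show (Equiv.ofBijective _ (dir_bijective φ e)) ⟨b, he⟩ = δ from hδ).trans
        ((Equiv.ofBijective _ (dir_bijective φ e)).apply_symm_apply δ).symm)
    exact congrArg Subtype.val this
  /- (3) every branch abuts (properness: every edge has verticial cardinality `2`) -/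
  have habuts : ∀ b : G.Branch, (G.abuts b).isSome := by
    intro b
    by_contra hb
    have h2 : G.vertCard (G.edgeOf b) = 2 := by
      rw [← hprop (G.edgeOf b)]
      exact IsGraph.vertCard_eq_two (bouquet_isGraph 1) _
    rw [vertCard, Nat.card_eq_two_iff] at h2
    obtain ⟨x, y, hxy, -⟩ := h2
    obtain ⟨b₁, b₂, -, -, -, hall⟩ := G.two_branches (G.edgeOf b)
    have hx : x.1 ≠ b := fun h => hb (h ▸ x.2.2)
    have hy : y.1 ≠ b := fun h => hb (h ▸ y.2.2)
    rcases hall b rfl with hb' | hb' <;> rcases hall x.1 x.2.1 with hx' | hx' <;>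
      rcases hall y.1 y.2.1 with hy' | hy'
    all_goals first
      | exact hx (hx'.trans hb'.symm)
      | exact hy (hy'.trans hb'.symm)
      | exact hxy (Subtype.ext (hx'.trans hy'.symm))
  let tgt : G.Branch → G.Vertex := fun b => (G.abuts b).get (habuts b)
  have htgt : ∀ b, G.abuts b = some (tgt b) := fun b => (Option.some_get (habuts b)).symm
  /- (4) the successor permutation "follow the leaving edge" -/
  let out : G.Vertex → G.Branch := fun v => (sb v true).1
  let inb : G.Vertex → G.Branch := fun v => (sb v false).1
  let succ : G.Vertex → G.Vertex := fun v => tgt (eb (G.edgeOf (out v)) false).1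
  let pred : G.Vertex → G.Vertex := fun v => tgt (eb (G.edgeOf (inb v)) true).1
  have hout_abuts : ∀ v, G.abuts (out v) = some v := fun v => (sb v true).2
  have hinb_abuts : ∀ v, G.abuts (inb v) = some v := fun v => (sb v false).2
  have hout_dir : ∀ v, (φ.branchMap (out v)).down.2 = true := fun v => hsb_dir v true
  have hinb_dir : ∀ v, (φ.branchMap (inb v)).down.2 = false := fun v => hsb_dir v false
  -- along an edge: from the vertex of its leaving branch to the vertex of its entering branch
  have hedge : ∀ (b b' : G.Branch) (v v' : G.Vertex), G.abuts b = some v →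
      (φ.branchMap b).down.2 = true → G.edgeOf b' = G.edgeOf b → (φ.branchMap b').down.2 = false →
      G.abuts b' = some v' → succ v = v' := by
    intro b b' v v' hb hδ he hδ' hb'
    have h1 : b = out v := hsb_uniq v true b hb hδ
    have h2 : b' = (eb (G.edgeOf (out v)) false).1 := heb_uniq _ false b' (by rw [he, h1]) hδ'
    change tgt (eb (G.edgeOf (out v)) false).1 = v'
    rw [← h2]
    exact Option.some.inj ((htgt b').symm.trans hb')
  have hpred_succ : ∀ v, pred (succ v) = v := by
    intro v
    have h1 : inb (succ v) = (eb (G.edgeOf (out v)) false).1 :=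
      (hsb_uniq _ false _ (htgt _) (heb_dir _ false)).symm
    change tgt (eb (G.edgeOf (inb (succ v))) true).1 = v
    rw [h1, (eb (G.edgeOf (out v)) false).2, ← heb_uniq _ true (out v) rfl (hout_dir v)]
    exact Option.some.inj ((htgt _).symm.trans (hout_abuts v))
  have hsucc_pred : ∀ v, succ (pred v) = v := by
    intro v
    have h1 : out (pred v) = (eb (G.edgeOf (inb v)) true).1 :=
      (hsb_uniq _ true _ (htgt _) (heb_dir _ true)).symm
    change tgt (eb (G.edgeOf (out (pred v))) false).1 = v
    rw [h1, (eb (G.edgeOf (inb v)) true).2, ← heb_uniq _ false (inb v) rfl (hinb_dir v)]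
    exact Option.some.inj ((htgt _).symm.trans (hinb_abuts v))
  have hsucc_inj : Function.Injective succ := Function.LeftInverse.injective hpred_succ
  /- (5) all vertices lie in the orbit of a base vertex `v₀` (connectedness) -/
  obtain ⟨v₀⟩ : Nonempty G.Vertex := by
    by_contra h
    rw [not_nonempty_iff] at h
    have := hcard ▸ (Nat.card_of_isEmpty (α := G.Vertex))
    omega
  let O : Set G.Vertex := {w | ∃ i : ℕ, succ^[i] v₀ = w}
  -- `v₀` is periodic under `succ`
  have hper : v₀ ∈ Function.periodicPts succ := by
    obtain ⟨i, j, hij, h⟩ := Finite.exists_ne_map_eq_of_infinite (fun i : ℕ => succ^[i] v₀)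
    rcases Nat.lt_or_gt_of_ne hij with hlt | hlt
    · refine Function.mk_mem_periodicPts (n := j - i) (by omega) ?_
      apply Function.Injective.iterate hsucc_inj i
      rw [← Function.iterate_add_apply, show i + (j - i) = j by omega]
      exact h.symm
    · refine Function.mk_mem_periodicPts (n := i - j) (by omega) ?_
      apply Function.Injective.iterate hsucc_inj j
      rw [← Function.iterate_add_apply, show j + (i - j) = i by omega]
      exact h
  let p := Function.minimalPeriod succ v₀
  have hp : 0 < p := Function.minimalPeriod_pos_of_mem_periodicPts hper
  have hO_succ : ∀ w ∈ O, succ w ∈ O := by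
    rintro w ⟨i, rfl⟩
    exact ⟨i + 1, by rw [Function.iterate_succ_apply']⟩
  have hO_pred : ∀ w ∈ O, pred w ∈ O := by
    rintro w ⟨i, rfl⟩
    refine ⟨i + (p - 1), ?_⟩
    apply hsucc_inj
    rw [hsucc_pred, ← Function.iterate_succ_apply' succ, show (i + (p - 1)).succ = i + p by omega,
      Function.iterate_add_apply, Function.iterate_minimalPeriod]
  -- the source vertex of an edge, and the invariant along the subdivision
  let src : G.Edge → G.Vertex := fun e => tgt (eb e true).1
  have hsucc_src : ∀ e, succ (src e) = tgt (eb e false).1 :=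
    fun e => hedge _ _ _ _ (htgt _) (heb_dir e true) (by rw [(eb e false).2, (eb e true).2])
      (heb_dir e false) (htgt _)
  let inO : G.Node → Prop := fun x =>
    match x with
    | Sum.inl w => w ∈ O
    | Sum.inr (Sum.inl e) => src e ∈ O
    | Sum.inr (Sum.inr b) => src (G.edgeOf b) ∈ O
  have hstep : ∀ x y : G.Node, G.NodeRel x y → (inO x ↔ inO y) := by
    intro x y hr
    cases hr with
    | edge_branch b => exact Iff.rfl
    | branch_vertex b w hw =>
      change src (G.edgeOf b) ∈ O ↔ w ∈ O
      rcases hδ : (φ.branchMap b).down.2 with _ | _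
      · -- entering branch: `w = succ (src e)`
        have hb : b = (eb (G.edgeOf b) false).1 := heb_uniq _ false b rfl hδ
        have hw' : w = succ (src (G.edgeOf b)) := by
          rw [hsucc_src, ← hb]
          exact Option.some.inj (hw.symm.trans (htgt b))
        rw [hw']
        exact ⟨hO_succ _, fun h => by simpa [hpred_succ] using hO_pred _ h⟩
      · -- leaving branch: `w = src e`
        have hb : b = (eb (G.edgeOf b) true).1 := heb_uniq _ true b rfl hδ
        have hw' : w = src (G.edgeOf b) := by
          change w = tgt (eb (G.edgeOf b) true).1
          rw [← hb]
          exact Option.some.inj (hw.symm.trans (htgt b))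
        rw [hw']
  have hall : ∀ w : G.Vertex, w ∈ O := by
    intro w
    have hv₀ : inO (Sum.inl v₀) := ⟨0, rfl⟩
    obtain ⟨walk⟩ := hG.connected (Sum.inl v₀ : G.Node) (Sum.inl w)
    suffices h : ∀ (x y : G.Node) (q : G.subdivision.Walk x y), inO x → inO y from h _ _ walk hv₀
    intro x y q
    induction q with
    | nil => exact id
    | cons hadj _ ih =>
      intro hx
      apply ih
      rcases (SimpleGraph.fromRel_adj _ _ _).1 hadj with ⟨-, hr | hr⟩
      · exact (hstep _ _ hr).1 hx
      · exact (hstep _ _ hr).2 hx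
  /- (6) the orbit is a cycle of length `p = n` -/
  have hsurj : ∀ w : G.Vertex, ∃ i, i < p ∧ succ^[i] v₀ = w := by
    intro w
    obtain ⟨i, rfl⟩ := hall w
    exact ⟨i % p, Nat.mod_lt _ hp, Function.iterate_mod_minimalPeriod_eq⟩
  let θ : Fin p → G.Vertex := fun i => succ^[i.1] v₀
  have hθ : Function.Bijective θ := by
    refine ⟨fun i j h => Fin.ext (Function.iterate_injOn_Iio_minimalPeriod i.2 j.2 h), fun w => ?_⟩
    obtain ⟨i, hi, rfl⟩ := hsurj w
    exact ⟨⟨i, hi⟩, rfl⟩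
  have hpn : p = n := by
    rw [← hcard, ← Nat.card_eq_of_bijective θ hθ, Nat.card_eq_fintype_card, Fintype.card_fin]
  let Θ : Fin p ≃ G.Vertex := Equiv.ofBijective θ hθ
  let idx : G.Vertex → ZMod n := fun w => ((Θ.symm w : Fin p) : ℕ)
  have hidx_θ : ∀ i : Fin p, idx (θ i) = (i : ℕ) := by
    intro i
    change (((Θ.symm (Θ i) : Fin p) : ℕ) : ZMod n) = _
    rw [Θ.symm_apply_apply]
  have hidx_inj : Function.Injective idx := by
    intro w w' h
    obtain ⟨i, rfl⟩ := Θ.surjective w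
    obtain ⟨j, rfl⟩ := Θ.surjective w'
    change idx (θ i) = idx (θ j) at h
    rw [hidx_θ, hidx_θ] at h
    have := congrArg ZMod.val h
    rw [ZMod.val_natCast, ZMod.val_natCast, Nat.mod_eq_of_lt (by omega), Nat.mod_eq_of_lt (by omega)]
      at this
    exact congrArg Θ (Fin.ext this)
  have hidx_surj : Function.Surjective idx := by
    intro k
    refine ⟨θ ⟨k.val, by rw [hpn]; exact k.val_lt⟩, ?_⟩
    rw [hidx_θ]
    exact ZMod.natCast_zmod_val k
  have hidx_succ : ∀ w, idx (succ w) = idx w + 1 := by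
    intro w
    obtain ⟨i, rfl⟩ := Θ.surjective w
    change idx (succ (θ i)) = idx (θ i) + 1
    have hs : succ (θ i) = θ ⟨(i.1 + 1) % p, Nat.mod_lt _ hp⟩ := by
      change succ (succ^[i.1] v₀) = succ^[(i.1 + 1) % p] v₀
      rw [Function.iterate_mod_minimalPeriod_eq, Function.iterate_succ_apply']
    rw [hs, hidx_θ, hidx_θ]
    change (((i.1 + 1) % p : ℕ) : ZMod n) = ((i.1 : ℕ) : ZMod n) + 1
    have hmod : (i.1 + 1) % p = (i.1 + 1) % n := congrArg (fun m => (i.1 + 1) % m) hpn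
    rw [hmod, ZMod.natCast_mod, Nat.cast_succ]
  refine ⟨idx, out, ⟨hidx_inj, hidx_surj⟩, hout_abuts, hout_dir, habuts, ?_⟩
  intro b b' v v' hb hδ he hδ' hb'
  rw [← hedge b b' v v' hb hδ he hδ' hb', hidx_succ]

end SemiGraph

end Literature.AnabelianGeometry.SemiGraphs
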